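import Literature.NumberTheory.Transcendental.SchneiderTwoWeierstrassAnalytic
import Literature.NumberTheory.Transcendental.SchneiderTwoWeierstrassBounds
import HarnessLib

/-!
# Schneider's theorem for two Weierstrass functions — the endgame; `exists_F₂_eq_zero`

Topic `Literature/NumberTheory/Transcendental` (family `periods`). Last proof file of the
two-lattice companion series of `SchneiderPeriodsAnalytic.lean` / `SchneiderPeriodsProofs.lean`
(series `SchneiderTwoWeierstrassDefs` → `…Analytic`, `…Values` → `…Arith` → `…Bounds` → this
file). It proves, in coefficient form, Schneider's 1937 theorem for two Weierstrass functions
(Baker 1975, Ch. 6, Thm 6.1 run as in the proof of Thm 6.3, p. 58, the second lattice being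
arbitrary):

*if `g₂(Λᵢ), g₃(Λᵢ)` are algebraic (`i = 1, 2`) and `l ∈ Λ₁ ∩ Λ₂` with `l/2 ∉ Λ₁`, `l/2 ∉ Λ₂`,
then there is a non-zero coefficient family `p` with `∑ p (i,k) ℘_{Λ₁}(z)ⁱ ℘_{Λ₂}(z)ᵏ = 0` for
all `z ∉ Λ₁ ∪ Λ₂`* (`exists_F₂_eq_zero`).

Contents — the two-lattice port of the second half of Part IV of `SchneiderPeriodsProofs.lean`
(Baker 1975, Ch. 6, §5), extrapolation-free:

* `Setup.exists_min_order` — the least order `s ≥ T + 1` of `F₂` at the `m` points and a point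
  `ν` with `γ = F₂^{(s)}(pt l ν) ≠ 0` (the orders are finite: by the field `hindep` of the
  `Setup`, `F₂` does not vanish identically, `analyticOrderAt_F₂_ne_top`);
* `Setup.elim : False` — with `C` from `norm_iteratedDeriv_F₂_le_of_zeros`, the comparison of
  `Setup.liouville` and `Setup.upper_bound`: `(s^{2h+1})^s ≤ (s^{2h} Θ)^s`, i.e. `s ≤ Θ`, against
  `s ≥ T + 1 = 2mu² > Θ` for `u = ⌈Θ⌉ + 1`;
* `exists_F₂_eq_zero` — by contradiction: the data would form a `Setup`.

The conversion to a bivariate polynomial relation `P(℘_{Λ₁}, ℘_{Λ₂}) = 0`, the commensurability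
`m Λ₁ ⊆ Λ₂` and the normalisation `l = 2^k l₀` are NOT here (sibling file
`SchneiderTwoWeierstrassCommensurable.lean`).

## References

* [Baker1975] A. Baker, *Transcendental Number Theory*, CUP 1975, Ch. 6 §§1–5, pp. 55–59
  (Thm 6.1, §5; proof of Thm 6.3 p. 58).
* [Schneider1937] Th. Schneider, *Arithmetische Untersuchungen elliptischer Integrale*,
  Math. Ann. 113 (1937), 1–13.
-/

noncomputable section

open Complex Metric Filter Set Finset
open _root_.Topology
open scoped PeriodPair

namespace Literature.NumberTheory.Transcendental.Schneider1937TwoP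

open Literature.NumberTheory.Transcendental.Schneider1937 (pt pt_notMem ρ₀ one_le_ρ₀)

/-! ## Part IV (second half) — the minimal order and the comparison

Baker 1975, Ch. 6, §5 (p. 59), in the extrapolation-free form: let `s` be the least order of
vanishing of `F₂` at the `m` points (`s ≥ T + 1`, all derivatives of order `< s` vanish at all
`m` points, `γ = F₂^{(s)}(pt l ν) ≠ 0` for some `ν`). Liouville (`Setup.liouville`) against
Schwarz–Cauchy (`Setup.upper_bound`) reads, with `m = 4(2h+1)`, `s^{(2h+1)s} ≤ s^{2hs} Θ^s`, i.e.
`s ≤ Θ` for a constant `Θ` of the data — absurd once `u` (`s ≥ T + 1 = 2mu²`) exceeds `Θ`.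
-/

section Endgame

open MvPolynomial NumberField

namespace Setup

variable (S : Setup)

/-- **The minimal order.** If `ξ ≠ 0` solves the system then there are `s ≥ T + 1` and `ν < m`
such that all derivatives of `F_{pC ξ}` of order `< s` vanish at all the points `pt l n`
(`n < m`) while `F_{pC ξ}^{(s)}(pt l ν) ≠ 0` (the orders are finite by
`analyticOrderAt_F₂_ne_top` and the field `hindep`). [cite: Baker1975, Ch. 6 §5 p. 59] -/
theorem exists_min_order {D T : ℕ} {ξ : Fin (D + 1) × Fin (D + 1) → 𝓞 S.K} (hξ : ξ ≠ 0)
    (hM : (S.Mat D T).mulVec ξ = 0) :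
    ∃ s : ℕ, T + 1 ≤ s ∧ ∃ ν : ℕ, ν < S.m ∧
      (∀ n < S.m, ∀ j < s, iteratedDeriv j (F₂ S.L₁ S.L₂ D (S.pC ξ)) (pt S.l n) = 0) ∧
      iteratedDeriv s (F₂ S.L₁ S.L₂ D (S.pC ξ)) (pt S.l ν) ≠ 0 := by
  classical
  set f := F₂ S.L₁ S.L₂ D (S.pC ξ) with hf
  have hp : S.pC ξ ≠ 0 := fun h => hξ ((S.pC_eq_zero_iff ξ).mp h)
  have han : ∀ n, AnalyticAt ℂ f (pt S.l n) := fun n => by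
    have h₁ := S.L₁.analyticOnNhd_weierstrassP _ (pt_notMem S.hl₁ S.hl2₁ n)
    have h₂ := S.L₂.analyticOnNhd_weierstrassP _ (pt_notMem S.hl₂ S.hl2₂ n)
    rw [hf]
    unfold F₂
    refine Finset.analyticAt_fun_sum _ fun ij _ => ?_
    exact analyticAt_const.mul ((h₁.pow _).mul (h₂.pow _))
  have hfin : ∀ n, analyticOrderAt f (pt S.l n) ≠ ⊤ := fun n =>
    analyticOrderAt_F₂_ne_top S.hl₁ S.hl2₁ S.hl₂ S.hl2₂ (S.F₂_ne_zero hp) n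
  set o : ℕ → ℕ := fun n => (analyticOrderAt f (pt S.l n)).toNat with hodef
  have ho : ∀ n, ((o n : ℕ) : ℕ∞) = analyticOrderAt f (pt S.l n) := fun n => ENat.coe_toNat (hfin n)
  have hne : (Finset.range S.m).Nonempty := ⟨0, Finset.mem_range.mpr S.one_le_m⟩
  obtain ⟨ν, hν, hmin⟩ := (Finset.range S.m).exists_min_image o hne
  have hνm : ν < S.m := Finset.mem_range.mp hν
  refine ⟨o ν, ?_, ν, hνm, ?_, ?_⟩
  · have h1 : ((T + 1 : ℕ) : ℕ∞) ≤ analyticOrderAt f (pt S.l ν) :=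
      (natCast_le_analyticOrderAt_iff_iteratedDeriv_eq_zero (han ν)).mpr
        fun j hj => S.iteratedDeriv_eq_zero_of_mulVec hM hνm hj
    rw [← ho] at h1
    exact_mod_cast h1
  · intro n hn j hj
    have hle : o ν ≤ o n := hmin n (Finset.mem_range.mpr hn)
    have h1 : ((o n : ℕ) : ℕ∞) ≤ analyticOrderAt f (pt S.l n) := (ho n).le
    exact (natCast_le_analyticOrderAt_iff_iteratedDeriv_eq_zero (han n)).mp h1 j (by omega)
  · intro h0
    have hall : ∀ j < o ν + 1, iteratedDeriv j f (pt S.l ν) = 0 := by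
      intro j hj
      rcases Nat.lt_succ_iff_lt_or_eq.mp hj with hj | rfl
      · exact (natCast_le_analyticOrderAt_iff_iteratedDeriv_eq_zero (han ν)).mp (ho ν).le j hj
      · exact h0
    have h1 : ((o ν + 1 : ℕ) : ℕ∞) ≤ analyticOrderAt f (pt S.l ν) :=
      (natCast_le_analyticOrderAt_iff_iteratedDeriv_eq_zero (han ν)).mpr hall
    rw [← ho] at h1
    have h2 : o ν + 1 ≤ o ν := by exact_mod_cast h1
    omega

end Setup

end Endgame

section Contradiction

open NumberField

namespace Setup

variable (S : Setup)

/-- `n ≤ 2^n` in `ℝ`. [folklore] -/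
private lemma nat_le_two_pow (n : ℕ) : (n : ℝ) ≤ 2 ^ n := by
  exact_mod_cast (Nat.lt_two_pow_self (n := n)).le

/-- `(√(√s))^4 = s`. [folklore] -/
private lemma sqrt_sqrt_pow_four {s : ℝ} (hs : 0 ≤ s) : Real.sqrt (Real.sqrt s) ^ 4 = s := by
  rw [show (4 : ℕ) = 2 * 2 by norm_num, pow_mul, Real.sq_sqrt (Real.sqrt_nonneg _), Real.sq_sqrt hs]

/-- **Schneider's two-℘ theorem — the contradiction** (Baker 1975, Ch. 6, §5): a `Setup` does not
exist. With the constant `C` of `norm_iteratedDeriv_F₂_le_of_zeros`, the bases `Θₐ = 21 C₀³`,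
`Θ_P, Θ_B, Θ_E` and `Θ = Θ_B^{h-1} |d|³ Θ_P Θ_E 2^m`, choose `u = ⌈Θ⌉ + 1`, `D + 1 = 2mu`,
`T + 1 = 2mu²`; Siegel's lemma gives `ξ`, the minimal order gives `s ≥ T + 1 > Θ` and `γ ≠ 0`,
and Liouville against Schwarz gives `(s^{2h+1})^s ≤ (s^{2h} Θ)^s`, i.e. `s ≤ Θ`.
[cite: Baker1975, Ch. 6 §5 p. 59] -/
theorem elim (S : Setup) : False := by
  obtain ⟨C, hC0, hC⟩ := norm_iteratedDeriv_F₂_le_of_zeros S.hl₁ S.hl2₁ S.hl₂ S.hl2₂ S.m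
  -- the constants of the data
  have hm1 := S.one_le_m_real
  have hC₀ := S.one_le_C₀
  have hCK := one_le_siegelConst S.K
  have hd1 : (1 : ℝ) ≤ |(S.d : ℝ)| := S.G.one_le_abs_den
  obtain ⟨h', hh'⟩ : ∃ h' : ℕ, S.G.h = h' + 1 := ⟨S.G.h - 1, (Nat.sub_add_cancel S.G.one_le_h).symm⟩
  have hmdef : S.m = 4 * (2 * h' + 3) := by unfold m; rw [hh']; ring
  set mR : ℝ := (S.m : ℝ) with hmR
  have hρ1 : 1 ≤ ρ₀ S.l S.m := one_le_ρ₀ S.m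
  set Θa : ℝ := 21 * S.C₀ ^ 3 with hΘa
  set ΘP : ℝ := 4 * siegelConst S.K ^ 2 * Θa with hΘP
  set ΘB : ℝ := 4 * ΘP * Θa with hΘB
  set ΘE : ℝ := Real.exp (C * (2 * mR + 8 * mR * (ρ₀ S.l S.m) ^ 2 + 1)) with hΘE
  set Θ : ℝ := ΘB ^ h' * |(S.d : ℝ)| ^ 3 * ΘP * ΘE * 2 ^ S.m with hΘ
  have hΘa1 : 1 ≤ Θa := by
    have h1 : (1 : ℝ) ≤ S.C₀ ^ 3 := one_le_pow₀ hC₀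
    rw [hΘa]; nlinarith
  have hΘP1 : 1 ≤ ΘP := by
    have : (1 : ℝ) ≤ siegelConst S.K ^ 2 := one_le_pow₀ hCK
    rw [hΘP]; nlinarith [one_le_mul_of_one_le_of_one_le this hΘa1]
  have hΘE1 : 1 ≤ ΘE := Real.one_le_exp (by positivity)
  have hΘ0 : 0 < Θ := by positivity
  -- the parameters
  have hm := S.one_le_m
  set u : ℕ := ⌈Θ⌉₊ + 1 with hu
  have hu1 : 1 ≤ u := by omega
  have huΘ : Θ < u := by
    rw [hu]; push_cast
    linarith [Nat.le_ceil Θ]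
  have hmu : 1 ≤ 2 * S.m * u := Nat.mul_pos (Nat.mul_pos two_pos hm) hu1
  have hmu2 : 1 ≤ 2 * S.m * u ^ 2 := Nat.mul_pos (Nat.mul_pos two_pos hm) (Nat.one_le_pow _ _ hu1)
  obtain ⟨D, hD⟩ : ∃ D : ℕ, D + 1 = 2 * S.m * u := ⟨2 * S.m * u - 1, Nat.sub_add_cancel hmu⟩
  obtain ⟨T, hT⟩ : ∃ T : ℕ, T + 1 = 2 * S.m * u ^ 2 := ⟨2 * S.m * u ^ 2 - 1, Nat.sub_add_cancel hmu2⟩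
  have huD : u ≤ D + 1 := by
    rw [hD]
    calc u = 1 * u := (one_mul u).symm
      _ ≤ 2 * S.m * u := Nat.mul_le_mul_right u (by omega)
  have hu_sq : u ≤ u ^ 2 := Nat.le_self_pow two_ne_zero u
  have hDT1 : D + 1 ≤ T + 1 := by rw [hD, hT]; exact Nat.mul_le_mul_left _ hu_sq
  have hu2T : u ^ 2 ≤ T + 1 := by
    rw [hT]
    calc u ^ 2 = 1 * u ^ 2 := (one_mul _).symm
      _ ≤ 2 * S.m * u ^ 2 := Nat.mul_le_mul_right _ (by omega)
  have hT1 : 1 ≤ T := by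
    have h2u : 2 ≤ u + u := by omega
    have : u + u ≤ T + 1 := by
      calc u + u = 2 * 1 * u := by ring
        _ ≤ 2 * S.m * u := Nat.mul_le_mul_right u (Nat.mul_le_mul_left 2 hm)
        _ = D + 1 := hD.symm
        _ ≤ T + 1 := hDT1
    omega
  -- Siegel's lemma and the minimal order
  obtain ⟨ξ, hξ0, hMξ, hhouse⟩ := S.exists_solution u hu1 hD hT
  obtain ⟨s, hsT, ν, hν, hzero, hγ⟩ := S.exists_min_order hξ0 hMξ
  -- elementary facts about `s`
  have hs1 : 1 ≤ s := by omega
  have hsR1 : (1 : ℝ) ≤ s := by exact_mod_cast hs1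
  have hsR0 : (0 : ℝ) < s := by linarith
  have hus : (u : ℝ) ≤ s := by exact_mod_cast (show u ≤ s by omega)
  have hu2s : (u : ℝ) ^ 2 ≤ s := by exact_mod_cast (show u ^ 2 ≤ s by omega)
  have hD1 : (D : ℝ) + 1 = 2 * mR * u := by rw [hmR]; exact_mod_cast hD
  have hDs : (D : ℝ) + 1 ≤ s := by exact_mod_cast (show D + 1 ≤ s by omega)
  have hDs' : 2 * D + s ≤ 3 * s := by omega
  have hDT' : 2 * D + T ≤ 3 * s := by omega
  have hTs : T ≤ s := by omega
  have hsqrt : (u : ℝ) ≤ Real.sqrt s := Real.le_sqrt_of_sq_le hu2s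
  -- the two bounds
  have LB := S.liouville hT1 hhouse hs1 hγ
  have UB := S.upper_bound hC hT1 hhouse hs1 hν hzero
  set γ : ℝ := ‖iteratedDeriv s (F₂ S.L₁ S.L₂ D (S.pC ξ)) (pt S.l ν)‖ with hγdef
  set q : ℝ := (((D + 1) ^ 2 : ℕ) : ℝ) with hq
  set B : ℝ := q * S.Pb D T * S.A D s with hB
  set E : ℝ := Real.exp (C * ((D + 1) * (1 + 4 * ρ₀ S.l S.m ^ 2 * Real.sqrt s) + s)) with hE
  set r : ℝ := Real.sqrt (Real.sqrt s) with hr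
  have hr0 : 0 < r := by rw [hr]; positivity
  have hPb1 := S.one_le_Pb D hT1
  have hB1 : 1 ≤ B := by
    have hq1 : (1 : ℝ) ≤ q := by rw [hq]; exact_mod_cast Nat.one_le_pow _ _ (by omega)
    exact one_le_mul_of_one_le_of_one_le (one_le_mul_of_one_le_of_one_le hq1 hPb1) (S.one_le_A D hs1)
  rw [hh', Nat.add_sub_cancel] at LB
  have hBh0 : 0 < B ^ h' := by positivity
  -- Step 1: `r^{sm} ≤ B^{h'} |d|^{2D+s} (Pb s! E) 2^{sm}`
  have key : r ^ (s * S.m) ≤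
      B ^ h' * |(S.d : ℝ)| ^ (2 * D + s) * (S.Pb D T * s.factorial * E) * 2 ^ (s * S.m) := by
    have h1 : 1 ≤ B ^ h' * (|(S.d : ℝ)| ^ (2 * D + s) * γ) := by
      rw [← inv_le_iff_one_le_mul₀' hBh0]
      have : ‖(S.d : ℂ) ^ (2 * D + s) * iteratedDeriv s (F₂ S.L₁ S.L₂ D (S.pC ξ)) (pt S.l ν)‖ =
          |(S.d : ℝ)| ^ (2 * D + s) * γ := by
        rw [norm_mul, norm_pow, Complex.norm_intCast]
      rw [← this]
      exact LB
    have h2 : γ ≤ S.Pb D T * s.factorial * E * ((2 : ℝ) ^ (s * S.m) / r ^ (s * S.m)) := by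
      rw [← div_pow]; exact UB
    have hrN : 0 ≤ r ^ (s * S.m) := (pow_pos hr0 _).le
    have hrN' : r ^ (s * S.m) ≠ 0 := (pow_pos hr0 _).ne'
    calc r ^ (s * S.m) = r ^ (s * S.m) * 1 := (mul_one _).symm
      _ ≤ r ^ (s * S.m) * (B ^ h' * (|(S.d : ℝ)| ^ (2 * D + s) * γ)) := by gcongr
      _ ≤ r ^ (s * S.m) * (B ^ h' * (|(S.d : ℝ)| ^ (2 * D + s) *
            (S.Pb D T * s.factorial * E * ((2 : ℝ) ^ (s * S.m) / r ^ (s * S.m))))) := by gcongr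
      _ = B ^ h' * |(S.d : ℝ)| ^ (2 * D + s) * (S.Pb D T * s.factorial * E) * 2 ^ (s * S.m) := by
          field_simp
  -- Step 2: the factors are `≤ (stuff)^s`
  have hq4 : q ≤ 4 ^ s := by
    have h1 : ((D + 1 : ℕ) : ℝ) ≤ 2 ^ s := by
      have := nat_le_two_pow s
      push_cast at hDs ⊢
      linarith
    calc q = (((D + 1 : ℕ) : ℝ)) ^ 2 := by rw [hq]; push_cast; ring
      _ ≤ (2 ^ s) ^ 2 := by gcongr
      _ = 4 ^ s := by rw [← pow_mul, mul_comm, pow_mul]; norm_num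
  have hAs : S.A D s ≤ ((s : ℝ) * Θa) ^ s := S.A_le hs1 le_rfl hDs'
  have hAT : S.A D T ≤ ((s : ℝ) * Θa) ^ s := S.A_le hT1 hTs hDT'
  have hA0T : 0 ≤ S.A D T := zero_le_one.trans (S.one_le_A D hT1)
  have hA0s : 0 ≤ S.A D s := zero_le_one.trans (S.one_le_A D hs1)
  have hPb : S.Pb D T ≤ ((s : ℝ) * ΘP) ^ s := by
    have hCK2 : siegelConst S.K ^ 2 ≤ (siegelConst S.K ^ 2) ^ s :=
      le_self_pow₀ (one_le_pow₀ hCK) (by omega)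
    calc S.Pb D T = siegelConst S.K ^ 2 * q * S.A D T := by rw [Pb, hq]; ring
      _ ≤ (siegelConst S.K ^ 2) ^ s * 4 ^ s * ((s : ℝ) * Θa) ^ s := by gcongr
      _ = ((s : ℝ) * ΘP) ^ s := by rw [← mul_pow, ← mul_pow, hΘP]; congr 1; ring
  have hBle : B ≤ ((s : ℝ) ^ 2 * ΘB) ^ s := by
    calc B = q * S.Pb D T * S.A D s := hB
      _ ≤ 4 ^ s * ((s : ℝ) * ΘP) ^ s * ((s : ℝ) * Θa) ^ s := by gcongr
      _ = ((s : ℝ) ^ 2 * ΘB) ^ s := by rw [← mul_pow, ← mul_pow, hΘB]; congr 1; ring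
  have hBh : B ^ h' ≤ (((s : ℝ) ^ 2 * ΘB) ^ h') ^ s := by
    calc B ^ h' ≤ (((s : ℝ) ^ 2 * ΘB) ^ s) ^ h' := pow_le_pow_left₀ (by positivity) hBle _
      _ = (((s : ℝ) ^ 2 * ΘB) ^ h') ^ s := pow_right_comm _ _ _
  have hdle : |(S.d : ℝ)| ^ (2 * D + s) ≤ (|(S.d : ℝ)| ^ 3) ^ s := by
    rw [← pow_mul]; exact pow_le_pow_right₀ hd1 (by omega)
  have hfact : (s.factorial : ℝ) ≤ (s : ℝ) ^ s := by
    exact_mod_cast Nat.factorial_le_pow s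
  have hEle : E ≤ ΘE ^ s := by
    rw [hE, hΘE, ← Real.exp_nat_mul]
    refine Real.exp_le_exp.mpr ?_
    have h1 : ((D : ℝ) + 1) * (1 + 4 * (ρ₀ S.l S.m) ^ 2 * Real.sqrt s) ≤
        2 * mR * (s : ℝ) + 8 * mR * (ρ₀ S.l S.m) ^ 2 * (s : ℝ) := by
      rw [hD1]
      have hss : (u : ℝ) * Real.sqrt (s : ℝ) ≤ (s : ℝ) := by
        calc (u : ℝ) * Real.sqrt (s : ℝ) ≤ Real.sqrt (s : ℝ) * Real.sqrt (s : ℝ) :=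
              mul_le_mul_of_nonneg_right hsqrt (Real.sqrt_nonneg _)
          _ = (s : ℝ) := Real.mul_self_sqrt hsR0.le
      have hm0 : (0 : ℝ) ≤ mR := by linarith
      have e1 : 2 * mR * u ≤ 2 * mR * s := by
        have := mul_le_mul_of_nonneg_left hus hm0
        linarith
      have e2 : 8 * mR * (ρ₀ S.l S.m) ^ 2 * ((u : ℝ) * Real.sqrt s) ≤
          8 * mR * (ρ₀ S.l S.m) ^ 2 * s :=
        mul_le_mul_of_nonneg_left hss (by positivity)
      calc 2 * mR * u * (1 + 4 * (ρ₀ S.l S.m) ^ 2 * Real.sqrt s)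
          = 2 * mR * u + 8 * mR * (ρ₀ S.l S.m) ^ 2 * ((u : ℝ) * Real.sqrt s) := by ring
        _ ≤ 2 * mR * s + 8 * mR * (ρ₀ S.l S.m) ^ 2 * s := add_le_add e1 e2
    have h2 : C * (((D : ℝ) + 1) * (1 + 4 * (ρ₀ S.l S.m) ^ 2 * Real.sqrt s) + s) ≤
        C * ((2 * mR + 8 * mR * (ρ₀ S.l S.m) ^ 2 + 1) * (s : ℝ)) := by
      refine mul_le_mul_of_nonneg_left ?_ hC0
      have : (2 * mR + 8 * mR * (ρ₀ S.l S.m) ^ 2 + 1) * (s : ℝ) =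
          2 * mR * (s : ℝ) + 8 * mR * (ρ₀ S.l S.m) ^ 2 * (s : ℝ) + s := by ring
      rw [this]
      linarith [h1]
    calc C * (((D : ℝ) + 1) * (1 + 4 * ρ₀ S.l S.m ^ 2 * Real.sqrt s) + s)
        ≤ C * ((2 * mR + 8 * mR * (ρ₀ S.l S.m) ^ 2 + 1) * (s : ℝ)) := h2
      _ = (s : ℕ) * (C * (2 * mR + 8 * mR * (ρ₀ S.l S.m) ^ 2 + 1)) := by ring
  have h2pow : (2 : ℝ) ^ (s * S.m) = (2 ^ S.m) ^ s := by rw [← pow_mul, mul_comm]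
  -- Step 3: the right-hand side is `≤ ((s : ℝ)^{2h'+2} Θ)^s`, the left-hand side is `((s : ℝ)^{2h'+3})^s`
  have hR : B ^ h' * |(S.d : ℝ)| ^ (2 * D + s) * (S.Pb D T * s.factorial * E) * 2 ^ (s * S.m) ≤
      ((s : ℝ) ^ (2 * h' + 2) * Θ) ^ s := by
    calc B ^ h' * |(S.d : ℝ)| ^ (2 * D + s) * (S.Pb D T * s.factorial * E) * 2 ^ (s * S.m)
        ≤ (((s : ℝ) ^ 2 * ΘB) ^ h') ^ s * (|(S.d : ℝ)| ^ 3) ^ s *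
            (((s : ℝ) * ΘP) ^ s * (s : ℝ) ^ s * ΘE ^ s) * (2 ^ S.m) ^ s := by
          rw [h2pow]
          gcongr
      _ = ((s : ℝ) ^ (2 * h' + 2) * Θ) ^ s := by rw [hΘ]; ring
  have hL : r ^ (s * S.m) = ((s : ℝ) ^ (2 * h' + 3)) ^ s := by
    have h4 : r ^ 4 = (s : ℝ) := by rw [hr]; exact sqrt_sqrt_pow_four hsR0.le
    rw [hmdef, show s * (4 * (2 * h' + 3)) = 4 * ((2 * h' + 3) * s) by ring, pow_mul, h4, pow_mul]
  -- Step 4: `(s : ℝ) ≤ Θ`, contradiction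
  have hfin : ((s : ℝ) ^ (2 * h' + 3)) ^ s ≤ ((s : ℝ) ^ (2 * h' + 2) * Θ) ^ s := hL ▸ key.trans hR
  have hfin' : (s : ℝ) ^ (2 * h' + 3) ≤ (s : ℝ) ^ (2 * h' + 2) * Θ :=
    (pow_le_pow_iff_left₀ (by positivity) (by positivity) (by omega)).mp hfin
  have hsΘ : (s : ℝ) ≤ Θ := by
    have h0 : 0 < (s : ℝ) ^ (2 * h' + 2) := by positivity
    rw [pow_succ, mul_le_mul_iff_of_pos_left h0] at hfin'
    exact hfin'
  linarith

end Setup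

end Contradiction

/-! ## Schneider's theorem for two Weierstrass functions, coefficient form -/

section Main

/-- **Schneider's theorem for two Weierstrass functions (coefficient form)** (Th. Schneider,
*Arithmetische Untersuchungen elliptischer Integrale*, Math. Ann. 113 (1937) 1–13; Baker 1975,
Ch. 6, proof of Thm 6.3, p. 58: "`℘(z), ℘(αz), ℘'(z), ℘'(αz)` simultaneously take values in a
number field when `z = (r + ½)ω₁` … we conclude that `℘(z)` and `℘(αz)` are algebraically
dependent", run here for an arbitrary second lattice). If `g₂(Λᵢ), g₃(Λᵢ)` are algebraic and
`l ∈ Λ₁ ∩ Λ₂` with `l/2 ∉ Λ₁`, `l/2 ∉ Λ₂`, then some non-zero coefficient family `p` of bidegree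
`≤ (D, D)` has `∑ p (i,k) ℘_{Λ₁}(z)ⁱ ℘_{Λ₂}(z)ᵏ = 0` for all `z ∉ Λ₁ ∪ Λ₂`: otherwise the data
form a `Setup`, refuted by `Setup.elim`. [cite: Schneider1937, Math. Ann. 113  Satz] -/
theorem exists_F₂_eq_zero (L₁ L₂ : PeriodPair) (h₂ : IsAlgebraic ℚ L₁.g₂)
    (h₃ : IsAlgebraic ℚ L₁.g₃) (h₂' : IsAlgebraic ℚ L₂.g₂) (h₃' : IsAlgebraic ℚ L₂.g₃) {l : ℂ}
    (hl₁ : l ∈ L₁.lattice) (hl₂ : l ∈ L₂.lattice) (hl2₁ : l / 2 ∉ L₁.lattice)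
    (hl2₂ : l / 2 ∉ L₂.lattice) :
    ∃ (D : ℕ) (p : Fin (D + 1) × Fin (D + 1) → ℂ), p ≠ 0 ∧
      ∀ z, z ∉ L₁.lattice → z ∉ L₂.lattice → F₂ L₁ L₂ D p z = 0 := by
  by_contra H
  push Not at H
  refine (Setup.mk L₁ L₂ l hl₁ hl₂ hl2₁ hl2₂ h₂ h₃ h₂' h₃' fun D p h0 => ?_).elim
  by_contra hp
  obtain ⟨z, hz₁, hz₂, hne⟩ := H D p hp
  exact hne (h0 z hz₁ hz₂)

end Main

end Literature.NumberTheory.Transcendental.Schneider1937TwoP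

end
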